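import Mathlib.Analysis.SpecialFunctions.ExpDeriv
import Mathlib.Analysis.Complex.RealDeriv
import Mathlib.Analysis.Calculus.FDeriv.Prod
import Mathlib.Analysis.Calculus.FDeriv.Mul
import Mathlib.Analysis.Calculus.Deriv.Slope
import Mathlib.Analysis.Calculus.Deriv.Prod
import Mathlib.Analysis.Calculus.Deriv.Mul
import Mathlib.Analysis.Calculus.Deriv.Inv
import Mathlib.LinearAlgebra.Matrix.SchurComplement
import Mathlib.LinearAlgebra.Matrix.ToLin
import Mathlib.Topology.Algebra.Module.FiniteDimension
import Mathlib.Algebra.MvPolynomial.PDeriv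
import HarnessLib

/-!
# Borinsky–Munch–Tellander 2023 §2.3 «Contour deformation» AS PRINTED: the embedding
# `ι_λ : x_e ↦ x_e exp(−iλ ∂𝒱/∂x_e(x))`, its Jacobian `𝒥_λ(x)^{e,h} = δ_{e,h} − iλ x_e ∂²𝒱/∂x_e∂x_h(x)`,
# and the first-order Landau expansion `𝒱(X) = 𝒱(x) − iλ Σ_e x_e (∂𝒱/∂x_e(x))² + 𝒪(λ²)` — PROVED

Topic `MathematicalPhysics/QuantumFieldTheory`, companion of `BorinskyMunchTellander2023/KinematicRegimes`
(§2.2: the regimes deciding WHETHER a deformation is needed).  This file types §2.3's algebra and calculus —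
what `feyntrop` evaluates at every sample point in the Minkowski regime — for an ARBITRARY function `𝒱`
differentiable at the point (the paper's `𝒱 = ℱ/𝒰`; the last section discharges the differentiability
hypothesis for every quotient of polynomials off the zero set of the denominator).

Source: M. Borinsky, H. J. Munch, F. Tellander, *Tropical Feynman integration in the Minkowski regime*,
Comput. Phys. Commun. 292 (2023) 108874 = arXiv:2302.08955v2 [cite: BorinskyMunchTellander2023, §2.3
(e-print `main.tex` l.411–470; art. §2.3)], VERBATIM:
* (eq:iota, l.425–429) "We will use the embedding ι_λ: ℙ^E_+ ↪ ℂℙ^{|E|−1} … given by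
  ι_λ : x_e ↦ x_e exp(−iλ ∂𝒱/∂x_e (x)). … As 𝒰 and ℱ are homogeneous polynomials of degree L and L+1
  respectively and 𝒱(x) = ℱ(x)/𝒰(x), the partial derivative ∂𝒱/∂x_e is a rational function in x of
  homogeneous degree 0, so ι_λ indeed respects projective equivalence."
* (l.431–433) "The deformation ι_λ does not change the boundary of ℙ^E_+ as each boundary face of ℙ^E_+ is
  characterized by at least one vanishing homogeneous coordinate x_e=0. So, ι_λ(∂ℙ^E_+) = ∂ℙ^E_+."
* (eq:Jlambda, l.438–442) "A computation on forms reveals that ι_λ^* Ω = det(𝒥_λ(x)) Ω, where the Jacobian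
  𝒥_λ(x) is the |E|×|E| matrix given element-wise by 𝒥_λ(x)^{e,h} = δ_{e,h} − iλ x_e ∂²𝒱/∂x_e∂x_h (x)
  for all e,h ∈ E."  (eq:deform, l.443–448) "… X = ι_λ(x), that means X = (X_0,…,X_{|E|−1}) and
  X_e = x_e exp(−iλ ∂𝒱/∂x_e (x)) for all e ∈ E."
* (Landau singularities, l.455–466) "consider the Taylor expansion of 𝒱(X) in λ,
  𝒱(X) = 𝒱(x) − iλ Σ_{e∈E} x_e (∂𝒱/∂x_e (x))² + 𝒪(λ²). The iε prescription in (eq:par) is ensured if the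
  imaginary part of 𝒱(X) is strictly negative for sufficiently small λ. This is the case for all x ∈ ℙ^E_+
  as long as there are no solutions of the Landau equations 0 = x_e ∂𝒱/∂x_e (x) for each e ∈ E, for any
  x ∈ ℙ^E_+, whose solutions are the Landau singularities."

WHAT IS TYPED (edge set `E` a `Fintype`; points `z : E → ℂ`, the real simplex embedded by `x ↦ (x_e : ℂ)`):
* `iotaDeform lam g z` = the vector `X_e = z_e exp(−i lam g_e)` for a given gradient vector `g`
  (= `∂𝒱/∂x_e(x)`), and `jacobianJ lam z H` = the printed matrix `δ_{e,h} − i lam z_e H_{e,h}` for a given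
  Hessian `H`; `jacobianJ_eq` (`𝒥_λ = 1 − iλ·diag(z)·H`);
* BOUNDARY: `iotaDeform_eq_zero_iff` (`X_e = 0 ↔ x_e = 0`); PROJECTIVE EQUIVALENCE: `iotaDeform_smul` (a
  degree-0 gradient field gives `ι_λ(t x) = t ι_λ(x)`);
* THE JACOBIAN: for a gradient FIELD `G` with `∂G_e/∂x_h = H_{e,h}` at `z`, the map `x ↦ ι_λ(x)` has
  derivative `diag(X_e/x_e) · 𝒥_λ(x)` (`hasFDerivAt_iotaDeform`), so `det(∂X/∂x) = Π_e (X_e/x_e) · det 𝒥_λ(x)`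
  (`det_fderiv_iotaDeform`) — the affine content of «ι_λ^* Ω = det(𝒥_λ) Ω» for the degree-0 form
  `Ω = Σ ± ∧_{j≠k} dx_j/x_j` (i.e. `∧_e dX_e/X_e = det 𝒥_λ · ∧_e dx_e/x_e`); and `det_jacobianJ_comm`: the
  printed `x_e`-placement and the transposed `x_h`-placement (`∂log X_e/∂log x_h`) have the same determinant;
* THE LANDAU EXPANSION: for ANY `𝒱` with `HasFDerivAt 𝒱 L z` and `g_e = L(δ_e)`,
  `d/dλ|_{λ=0} 𝒱(ι_λ(z)) = −i Σ_e z_e g_e²` (`hasDerivAt_comp_iotaDeform`; real-λ version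
  `hasDerivAt_comp_iotaDeform_real`); at a REAL point with REAL gradient the imaginary part has derivative
  `−Σ_e x_e (∂𝒱/∂x_e)²` (`hasDerivAt_im_comp_iotaDeform`), hence **if `x` is not a Landau point
  (`x_e ≥ 0`, some `x_e ∂𝒱/∂x_e(x) ≠ 0`) then `Im 𝒱(X) < Im 𝒱(x)` for all sufficiently small `λ > 0`**
  (`im_comp_iotaDeform_lt_eventually`; `= 0` when `𝒱(x)` is real: `im_comp_iotaDeform_neg_eventually`);
* POLYNOMIAL `𝒱`: `differentiable_mvPolynomial_eval`, `differentiableAt_eval_div_eval` — the hypothesis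
  `HasFDerivAt 𝒱 L z` holds for `𝒱 = ℱ/𝒰` at every `z` with `𝒰(z) ≠ 0`.
NOT typed: differential forms on `ℂℙ^{|E|−1}` and Cauchy's theorem (eq:deform_formal) — the contour move
itself; the UNIFORM negativity of `Im 𝒱(X)` on the whole simplex for one finite `λ` (that is Assumption 3.2's
territory, printed as an assumption); Euler's theorem for `ℱ/𝒰` (degree-0 gradient is the HYPOTHESIS of
`iotaDeform_smul`); anything about `𝒰(X)`, the ε-expansion or the sampler.  (Filed by the pub-qed
TROPICAL-track literature seat trop-lit g32, SOURCES A46; VALUE-FREE; independent recomputation; no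
new-physics claim.)
-/

noncomputable section

open Complex Matrix Finset Filter Topology

namespace Literature.MathematicalPhysics.QuantumFieldTheory.BorinskyMunchTellander2023

variable {E : Type*}

/-! ## The embedding `ι_λ` as printed -/

/-- **(eq:iota)** `ι_λ : x_e ↦ X_e = x_e exp(−iλ ∂𝒱/∂x_e(x))`, as a function of the deformation parameter
`lam`, the GRADIENT VECTOR `g_e = ∂𝒱/∂x_e(x)` at the point, and the point `z` (complex coordinates; the
simplex is `z_e = x_e ≥ 0`). [cite: BorinskyMunchTellander2023, §2.3 eq. (iota) (main.tex l.425–429); eq. (deform) (l.443–448)] -/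
def iotaDeform (lam : ℂ) (g z : E → ℂ) : E → ℂ := fun e => z e * Complex.exp (-(Complex.I * lam * g e))

/-- Unfolding `ι_λ`. [cite: BorinskyMunchTellander2023, §2.3 eq. (iota) (main.tex l.425–429)] -/
theorem iotaDeform_apply (lam : ℂ) (g z : E → ℂ) (e : E) :
    iotaDeform lam g z e = z e * Complex.exp (-(Complex.I * lam * g e)) := rfl

/-- At `λ = 0` the deformation is the identity, `ι_0(x) = x`. [cite: BorinskyMunchTellander2023, §2.3 (main.tex l.425–429); §4.2 «we set λ = 0, in which case we have X = x» (l.1100)] -/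
theorem iotaDeform_zero (g z : E → ℂ) : iotaDeform 0 g z = z := by
  funext e
  simp [iotaDeform_apply]

/-- **«The deformation ι_λ does not change the boundary of ℙ^E_+»**: `X_e = 0 ↔ x_e = 0`.
[cite: BorinskyMunchTellander2023, §2.3 (main.tex l.431–433)] -/
theorem iotaDeform_eq_zero_iff (lam : ℂ) (g z : E → ℂ) (e : E) : iotaDeform lam g z e = 0 ↔ z e = 0 := by
  rw [iotaDeform_apply, mul_eq_zero, or_iff_left (Complex.exp_ne_zero _)]

/-- **«ι_λ indeed respects projective equivalence»**: if the gradient field is homogeneous of degree `0`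
(`G(t x) = G(x)` — the printed premise for `𝒱 = ℱ/𝒰`), then `ι_λ(t x) = t · ι_λ(x)`.
[cite: BorinskyMunchTellander2023, §2.3 (main.tex l.429)] -/
theorem iotaDeform_smul {G : (E → ℂ) → (E → ℂ)} {t : ℂ} {z : E → ℂ} (hG : G (t • z) = G z) (lam : ℂ) :
    iotaDeform lam (G (t • z)) (t • z) = t • iotaDeform lam (G z) z := by
  funext e
  simp only [iotaDeform_apply, hG, Pi.smul_apply, smul_eq_mul]
  ring

/-- The factor `exp(−iλ g_e) = X_e/x_e` off the coordinate hyperplanes. [cite: BorinskyMunchTellander2023, §2.3 eq. (deform) (main.tex l.443–448)] -/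
theorem exp_eq_iotaDeform_div {g z : E → ℂ} {e : E} (hz : z e ≠ 0) (lam : ℂ) :
    Complex.exp (-(Complex.I * lam * g e)) = iotaDeform lam g z e / z e := by
  rw [iotaDeform_apply, mul_div_cancel_left₀ _ hz]

/-! ## The matrix `𝒥_λ` as printed -/

variable [DecidableEq E]

/-- **(eq:Jlambda)** `𝒥_λ(x)^{e,h} = δ_{e,h} − iλ x_e ∂²𝒱/∂x_e∂x_h(x)` for a given HESSIAN `H_{e,h}` at the point.
[cite: BorinskyMunchTellander2023, §2.3 eq. (Jlambda) (main.tex l.438–442)] -/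
def jacobianJ (lam : ℂ) (z : E → ℂ) (H : Matrix E E ℂ) : Matrix E E ℂ :=
  Matrix.of fun e h => (if e = h then 1 else 0) - Complex.I * lam * z e * H e h

/-- Unfolding `𝒥_λ`. [cite: BorinskyMunchTellander2023, §2.3 eq. (Jlambda) (main.tex l.438–442)] -/
theorem jacobianJ_apply (lam : ℂ) (z : E → ℂ) (H : Matrix E E ℂ) (e h : E) :
    jacobianJ lam z H e h = (if e = h then 1 else 0) - Complex.I * lam * z e * H e h := rfl

variable [Fintype E]

/-- `𝒥_λ = 1 − iλ · diag(x) · H` as matrices. [cite: BorinskyMunchTellander2023, §2.3 eq. (Jlambda) (main.tex l.438–442)] -/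
theorem jacobianJ_eq (lam : ℂ) (z : E → ℂ) (H : Matrix E E ℂ) :
    jacobianJ lam z H = 1 - (Complex.I * lam) • (Matrix.diagonal z * H) := by
  ext e h
  simp only [jacobianJ_apply, Matrix.sub_apply, Matrix.one_apply, Matrix.smul_apply, Matrix.diagonal_mul,
    smul_eq_mul]
  ring

/-- The printed placement `x_e` (row scaling) and the transposed placement `x_h` (`∂log X_e/∂log x_h =
δ_{e,h} − iλ x_h H_{e,h}`, column scaling) give the same determinant: `det(1 − iλ diag(x) H) = det(1 − iλ H diag(x))`
(Mathlib's `det(1 − AB) = det(1 − BA)`). [cite: BorinskyMunchTellander2023, §2.3 eq. (Jlambda) (main.tex l.438–442)] -/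
theorem det_jacobianJ_comm (lam : ℂ) (z : E → ℂ) (H : Matrix E E ℂ) :
    (jacobianJ lam z H).det = (1 - (Complex.I * lam) • (H * Matrix.diagonal z)).det := by
  rw [jacobianJ_eq, ← Matrix.smul_mul, Matrix.det_one_sub_mul_comm, Matrix.mul_smul]

/-! ## The Jacobian of `x ↦ ι_λ(x)`: `∂X_e/∂x_h = (X_e/x_e) · 𝒥_λ(x)^{e,h}` -/

/-- The full Jacobian matrix `diag(d) · 𝒥_λ(x)` applied to a vector: row `e` is
`d_e (v_e − iλ x_e Σ_h H_{e,h} v_h)`. Plumbing. [cite: BorinskyMunchTellander2023, §2.3 eq. (Jlambda) (main.tex l.438–442)] -/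
theorem toLin'_diagonal_mul_jacobianJ_apply (lam : ℂ) (z d : E → ℂ) (H : Matrix E E ℂ) (v : E → ℂ) (e : E) :
    (Matrix.toLin' (Matrix.diagonal d * jacobianJ lam z H)) v e
      = d e * (v e - Complex.I * lam * z e * ∑ h, H e h * v h) := by
  rw [Matrix.toLin'_apply, Matrix.mulVec, dotProduct]
  simp only [Matrix.diagonal_mul, jacobianJ_apply]
  calc ∑ h, d e * ((if e = h then 1 else 0) - Complex.I * lam * z e * H e h) * v h
      = d e * ∑ h, ((if e = h then 1 else 0) * v h - Complex.I * lam * z e * (H e h * v h)) := by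
        rw [Finset.mul_sum]
        exact Finset.sum_congr rfl fun h _ => by ring
    _ = d e * ((∑ h, (if e = h then 1 else 0) * v h) - Complex.I * lam * z e * ∑ h, H e h * v h) := by
        rw [Finset.sum_sub_distrib, Finset.mul_sum]
    _ = d e * (v e - Complex.I * lam * z e * ∑ h, H e h * v h) := by
        congr 2
        simp only [ite_mul, one_mul, zero_mul, Finset.sum_ite_eq, Finset.mem_univ, if_true]

/-- **The Jacobian of the deformation** («A computation on forms reveals …»): if `G` is the gradient field
with `∂G_e/∂x_h(x) = H_{e,h}` (so `H` is the Hessian of `𝒱` when `G = ∇𝒱`), then `x ↦ ι_λ(x)`,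
`X_e = x_e exp(−iλ G_e(x))`, has derivative `diag(X_e/x_e) · 𝒥_λ(x)` at `x`, i.e.
`∂X_e/∂x_h = exp(−iλ G_e(x)) (δ_{e,h} − iλ x_e H_{e,h})`.
[cite: BorinskyMunchTellander2023, §2.3 eq. (Jlambda) (main.tex l.438–442); eq. (deform) (l.443–448)] -/
theorem hasFDerivAt_iotaDeform {G : (E → ℂ) → (E → ℂ)} {H : Matrix E E ℂ} {z : E → ℂ}
    (hG : ∀ e, HasFDerivAt (fun w => G w e)
      (∑ h, H e h • (ContinuousLinearMap.proj (R := ℂ) (φ := fun _ : E => ℂ) h)) z) (lam : ℂ) :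
    HasFDerivAt (fun w => iotaDeform lam (G w) w)
      (LinearMap.toContinuousLinearMap (Matrix.toLin'
        (Matrix.diagonal (fun e => Complex.exp (-(Complex.I * lam * G z e))) * jacobianJ lam z H))) z := by
  rw [hasFDerivAt_pi']
  intro e
  -- the `e`-th component: `w ↦ w_e * exp(−iλ G_e(w))`
  have h1 : HasFDerivAt (fun w : E → ℂ => w e)
      (ContinuousLinearMap.proj (R := ℂ) (φ := fun _ : E => ℂ) e) z := hasFDerivAt_apply e z
  have h2 : HasFDerivAt (fun w : E → ℂ => -(Complex.I * lam * G w e))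
      (-((Complex.I * lam) • ∑ h, H e h • (ContinuousLinearMap.proj (R := ℂ) (φ := fun _ : E => ℂ) h))) z :=
    ((hG e).const_mul (Complex.I * lam)).neg
  have h4 := h1.mul h2.cexp
  show HasFDerivAt (fun w : E → ℂ => w e * Complex.exp (-(Complex.I * lam * G w e))) _ z
  refine h4.congr_fderiv (ContinuousLinearMap.ext fun v => ?_)
  have hR : ((ContinuousLinearMap.proj (R := ℂ) (φ := fun _ : E => ℂ) e).comp
      (LinearMap.toContinuousLinearMap (Matrix.toLin'
        (Matrix.diagonal (fun e => Complex.exp (-(Complex.I * lam * G z e))) * jacobianJ lam z H)))) v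
      = Complex.exp (-(Complex.I * lam * G z e)) * (v e - Complex.I * lam * z e * ∑ h, H e h * v h) :=
    toLin'_diagonal_mul_jacobianJ_apply lam z _ H v e
  rw [hR]
  simp only [_root_.add_apply, _root_.smul_apply, _root_.neg_apply, FunLike.coe_sum, Finset.sum_apply,
    ContinuousLinearMap.proj_apply, smul_eq_mul]
  ring

/-- **«ι_λ^* Ω = det(𝒥_λ(x)) Ω» in the affine reading**: the determinant of the Jacobian of `x ↦ ι_λ(x)` is
`Π_e exp(−iλ G_e(x)) · det 𝒥_λ(x) = Π_e (X_e/x_e) · det 𝒥_λ(x)`; equivalently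
`∧_e dX_e/X_e = det 𝒥_λ(x) · ∧_e dx_e/x_e` for Borinsky's degree-0 form. [cite: BorinskyMunchTellander2023, §2.3 eq. (Jlambda) (main.tex l.438–442)] -/
theorem det_fderiv_iotaDeform (lam : ℂ) (z : E → ℂ) (G : (E → ℂ) → (E → ℂ)) (H : Matrix E E ℂ) :
    (LinearMap.toContinuousLinearMap (Matrix.toLin'
        (Matrix.diagonal (fun e => Complex.exp (-(Complex.I * lam * G z e))) * jacobianJ lam z H))).det
      = (∏ e, Complex.exp (-(Complex.I * lam * G z e))) * (jacobianJ lam z H).det := by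
  unfold ContinuousLinearMap.det
  rw [LinearMap.coe_toContinuousLinearMap, LinearMap.det_toLin', Matrix.det_mul, Matrix.det_diagonal]

/-! ## The first-order Landau expansion `𝒱(X) = 𝒱(x) − iλ Σ_e x_e (∂𝒱/∂x_e)² + 𝒪(λ²)` -/

omit [Fintype E] [DecidableEq E] in
/-- The `λ`-derivative of the deformed point: `d/dλ X_e = −i g_e · z_e exp(−iλ g_e)`; at `λ = 0` it is
`−i g_e z_e`. [cite: BorinskyMunchTellander2023, §2.3 (main.tex l.455–458)] -/
theorem hasDerivAt_iotaDeform_lam (g z : E → ℂ) (lam : ℂ) :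
    HasDerivAt (fun l : ℂ => iotaDeform l g z)
      (fun e => z e * (Complex.exp (-(Complex.I * lam * g e)) * -(Complex.I * g e))) lam := by
  rw [hasDerivAt_pi]
  intro e
  have h1 : HasDerivAt (fun l : ℂ => -(Complex.I * l * g e)) (-(Complex.I * g e)) lam := by
    have := ((hasDerivAt_id' lam).const_mul Complex.I).mul_const (g e)
    rw [mul_one] at this
    exact this.fun_neg
  exact (h1.cexp).const_mul (z e)

/-- A continuous linear functional on `ℂ^E` is `v ↦ Σ_e v_e · L(δ_e)` — the gradient read off `L`.
Plumbing. [cite: BorinskyMunchTellander2023, §2.3 (main.tex l.455–458)] -/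
theorem clm_apply_eq_sum_mul_single (L : (E → ℂ) →L[ℂ] ℂ) (v : E → ℂ) :
    L v = ∑ e, v e * L (Pi.single e 1) := by
  have hv : v = ∑ e, v e • (Pi.single e (1 : ℂ) : E → ℂ) := by
    funext h
    simp only [Finset.sum_apply, Pi.smul_apply, smul_eq_mul, Pi.single_apply, mul_ite, mul_one, mul_zero]
    rw [Finset.sum_ite_eq, if_pos (Finset.mem_univ h)]
  conv_lhs => rw [hv]
  rw [map_sum]
  exact Finset.sum_congr rfl fun e _ => by rw [map_smul, smul_eq_mul]

/-- **The Taylor expansion of `𝒱(X)` in `λ`, first order**: for ANY `𝒱` differentiable at `z` with derivative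
`L` and gradient `g_e = L(δ_e) = ∂𝒱/∂x_e(z)`,
`d/dλ|_{λ=0} 𝒱(ι_λ(z)) = −i Σ_e z_e g_e²` — i.e. `𝒱(X) = 𝒱(x) − iλ Σ_e x_e (∂𝒱/∂x_e(x))² + 𝒪(λ²)`
in the sense of the derivative at `λ = 0` (complex `λ`). [cite: BorinskyMunchTellander2023, §2.3 «Landau singularities» (main.tex l.455–458)] -/
theorem hasDerivAt_comp_iotaDeform {𝒱 : (E → ℂ) → ℂ} {L : (E → ℂ) →L[ℂ] ℂ} {z : E → ℂ}
    (h𝒱 : HasFDerivAt 𝒱 L z) :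
    HasDerivAt (fun lam : ℂ => 𝒱 (iotaDeform lam (fun e => L (Pi.single e 1)) z))
      (-(Complex.I * ∑ e, z e * (L (Pi.single e 1)) ^ 2)) 0 := by
  set g : E → ℂ := fun e => L (Pi.single e 1) with hg
  have hX := hasDerivAt_iotaDeform_lam g z 0
  have h0 : iotaDeform 0 g z = z := iotaDeform_zero g z
  have h𝒱' : HasFDerivAt 𝒱 L (iotaDeform 0 g z) := by rw [h0]; exact h𝒱
  have hcomp := h𝒱'.comp_hasDerivAt (0 : ℂ) hX
  have hval : L (fun e => z e * (Complex.exp (-(Complex.I * 0 * g e)) * -(Complex.I * g e)))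
      = -(Complex.I * ∑ e, z e * g e ^ 2) := by
    rw [clm_apply_eq_sum_mul_single, Finset.mul_sum, ← Finset.sum_neg_distrib]
    refine Finset.sum_congr rfl fun e _ => ?_
    simp only [mul_zero, zero_mul, neg_zero, Complex.exp_zero, one_mul]
    ring
  rw [hval] at hcomp
  exact hcomp

/-- The same expansion along REAL `λ` (the paper's deformation parameter is real).
[cite: BorinskyMunchTellander2023, §2.3 «Landau singularities» (main.tex l.455–458)] -/
theorem hasDerivAt_comp_iotaDeform_real {𝒱 : (E → ℂ) → ℂ} {L : (E → ℂ) →L[ℂ] ℂ} {z : E → ℂ}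
    (h𝒱 : HasFDerivAt 𝒱 L z) :
    HasDerivAt (fun lam : ℝ => 𝒱 (iotaDeform (lam : ℂ) (fun e => L (Pi.single e 1)) z))
      (-(Complex.I * ∑ e, z e * (L (Pi.single e 1)) ^ 2)) 0 := by
  have h := hasDerivAt_comp_iotaDeform h𝒱
  rw [← Complex.ofReal_zero] at h
  exact h.comp_ofReal

/-- **The imaginary part to first order at a REAL point with REAL gradient** (the simplex `x_e ∈ ℝ`,
`∂𝒱/∂x_e(x) ∈ ℝ` — e.g. `𝒱 = ℱ/𝒰` with real kinematics): `d/dλ|_{λ=0} Im 𝒱(ι_λ(x)) = −Σ_e x_e (∂𝒱/∂x_e(x))²`.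
[cite: BorinskyMunchTellander2023, §2.3 «Landau singularities» (main.tex l.455–462)] -/
theorem hasDerivAt_im_comp_iotaDeform {𝒱 : (E → ℂ) → ℂ} {L : (E → ℂ) →L[ℂ] ℂ} {x r : E → ℝ}
    (h𝒱 : HasFDerivAt 𝒱 L (fun e => (x e : ℂ))) (hr : ∀ e, L (Pi.single e 1) = (r e : ℂ)) :
    HasDerivAt (fun lam : ℝ =>
        (𝒱 (iotaDeform (lam : ℂ) (fun e => L (Pi.single e 1)) (fun e => (x e : ℂ)))).im)
      (-(∑ e, x e * r e ^ 2)) 0 := by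
  have h := hasDerivAt_comp_iotaDeform_real h𝒱
  have him := (Complex.imCLM.hasFDerivAt.comp_hasDerivAt (0 : ℝ) h)
  have hval : Complex.imCLM (-(Complex.I * ∑ e, (x e : ℂ) * (L (Pi.single e 1)) ^ 2))
      = -(∑ e, x e * r e ^ 2) := by
    simp only [hr, Complex.imCLM_apply]
    have hs : (∑ e, (x e : ℂ) * (r e : ℂ) ^ 2) = ((∑ e, x e * r e ^ 2 : ℝ) : ℂ) := by
      push_cast
      rfl
    rw [hs, Complex.neg_im, Complex.I_mul_im, Complex.ofReal_re]
  rw [hval] at him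
  exact him

/-- **«The imaginary part of 𝒱(X) is strictly negative for sufficiently small λ … as long as there are no
solutions of the Landau equations 0 = x_e ∂𝒱/∂x_e(x) for each e»** — POINTWISE form: at a point of the
simplex (`x_e ≥ 0`) that is not a Landau point (some `x_e ∂𝒱/∂x_e(x) ≠ 0`), with real gradient,
`Im 𝒱(ι_λ(x)) < Im 𝒱(x)` for all sufficiently small `λ > 0`.  (Uniformity in `x` for one finite `λ` is NOT
claimed — that is the territory of the paper's Assumption 3.2.)
[cite: BorinskyMunchTellander2023, §2.3 «Landau singularities», eq. (landau) (main.tex l.455–466)] -/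
theorem im_comp_iotaDeform_lt_eventually {𝒱 : (E → ℂ) → ℂ} {L : (E → ℂ) →L[ℂ] ℂ} {x r : E → ℝ}
    (h𝒱 : HasFDerivAt 𝒱 L (fun e => (x e : ℂ))) (hr : ∀ e, L (Pi.single e 1) = (r e : ℂ))
    (hx : ∀ e, 0 ≤ x e) (hL : ∃ e, x e * r e ≠ 0) :
    ∀ᶠ lam : ℝ in 𝓝[>] 0,
      (𝒱 (iotaDeform (lam : ℂ) (fun e => L (Pi.single e 1)) (fun e => (x e : ℂ)))).im
        < (𝒱 (fun e => (x e : ℂ))).im := by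
  set f : ℝ → ℝ := fun lam =>
    (𝒱 (iotaDeform (lam : ℂ) (fun e => L (Pi.single e 1)) (fun e => (x e : ℂ)))).im with hf
  have hder : HasDerivAt f (-(∑ e, x e * r e ^ 2)) 0 := hasDerivAt_im_comp_iotaDeform h𝒱 hr
  -- the derivative is strictly negative off the Landau locus
  have hpos : 0 < ∑ e, x e * r e ^ 2 := by
    obtain ⟨e₀, he₀⟩ := hL
    have hx0 : 0 < x e₀ := lt_of_le_of_ne (hx e₀) (fun h => he₀ (by rw [← h, zero_mul]))
    have hr0 : r e₀ ≠ 0 := fun h => he₀ (by rw [h, mul_zero])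
    refine lt_of_lt_of_le (mul_pos hx0 (sq_pos_iff.mpr hr0)) ?_
    exact Finset.single_le_sum (f := fun e => x e * r e ^ 2)
      (fun e _ => mul_nonneg (hx e) (sq_nonneg _)) (Finset.mem_univ e₀)
  have hf0 : f 0 = (𝒱 (fun e => (x e : ℂ))).im := by
    simp only [hf, Complex.ofReal_zero, iotaDeform_zero]
  -- slope form of the derivative, restricted to `λ > 0`
  have hslope := (hasDerivAt_iff_tendsto_slope.mp hder).mono_left
    (nhdsWithin_mono _ (fun l (hl : l ∈ Set.Ioi (0 : ℝ)) => ne_of_gt hl))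
  have hev : ∀ᶠ lam in 𝓝[>] (0 : ℝ), slope f 0 lam < 0 :=
    hslope.eventually (gt_mem_nhds (by linarith))
  filter_upwards [hev, self_mem_nhdsWithin] with lam hlam hpos'
  rw [slope_def_field, sub_zero] at hlam
  rw [← hf0]
  have hlt : f lam - f 0 < 0 := by
    rcases div_neg_iff.mp hlam with ⟨_, hb⟩ | ⟨ha, _⟩
    · exact absurd hb (not_lt.mpr (le_of_lt hpos'))
    · exact ha
  linarith

/-- … and if `𝒱(x)` is real (as for `𝒱 = ℱ/𝒰` at real kinematics), `Im 𝒱(X) < 0` for all sufficiently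
small `λ > 0`. [cite: BorinskyMunchTellander2023, §2.3 «Landau singularities» (main.tex l.459–466)] -/
theorem im_comp_iotaDeform_neg_eventually {𝒱 : (E → ℂ) → ℂ} {L : (E → ℂ) →L[ℂ] ℂ} {x r : E → ℝ}
    (h𝒱 : HasFDerivAt 𝒱 L (fun e => (x e : ℂ))) (hr : ∀ e, L (Pi.single e 1) = (r e : ℂ))
    (hx : ∀ e, 0 ≤ x e) (hL : ∃ e, x e * r e ≠ 0) (hreal : (𝒱 (fun e => (x e : ℂ))).im = 0) :
    ∀ᶠ lam : ℝ in 𝓝[>] 0,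
      (𝒱 (iotaDeform (lam : ℂ) (fun e => L (Pi.single e 1)) (fun e => (x e : ℂ)))).im < 0 := by
  have h := im_comp_iotaDeform_lt_eventually h𝒱 hr hx hL
  rw [hreal] at h
  exact h

/-! ## Discharging the differentiability hypothesis for `𝒱 = ℱ/𝒰` -/

omit [DecidableEq E] in
/-- Polynomial functions `z ↦ p(z)` on `ℂ^E` are differentiable (induction on `p`). Elementary.
[cite: BorinskyMunchTellander2023, §2.3 (main.tex l.429) «∂𝒱/∂x_e is a rational function in x»] -/
theorem differentiable_mvPolynomial_eval (p : MvPolynomial E ℂ) :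
    Differentiable ℂ (fun z : E → ℂ => MvPolynomial.eval z p) := by
  induction p using MvPolynomial.induction_on with
  | C a =>
    simp only [MvPolynomial.eval_C]
    exact differentiable_const a
  | add p q hp hq =>
    simp only [map_add]
    exact hp.add hq
  | mul_X p e hp =>
    simp only [map_mul, MvPolynomial.eval_X]
    exact hp.mul (differentiable_apply e)

omit [DecidableEq E] in
/-- `𝒱 = ℱ/𝒰` (any two polynomials) is differentiable at every point where the denominator does not vanish —
so `hasDerivAt_comp_iotaDeform` applies to the paper's `𝒱` at every `x` with `𝒰(x) ≠ 0` (on the open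
simplex `𝒰 > 0`). [cite: BorinskyMunchTellander2023, §2.3 (main.tex l.425–429) «𝒱(x) = ℱ(x)/𝒰(x)»] -/
theorem differentiableAt_eval_div_eval (F U : MvPolynomial E ℂ) {z : E → ℂ}
    (hU : MvPolynomial.eval z U ≠ 0) :
    DifferentiableAt ℂ (fun w : E → ℂ => MvPolynomial.eval w F / MvPolynomial.eval w U) z := by
  have hdiv : (fun w : E → ℂ => MvPolynomial.eval w F / MvPolynomial.eval w U)
      = fun w => MvPolynomial.eval w F * (MvPolynomial.eval w U)⁻¹ := by
    funext w
    rw [div_eq_mul_inv]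
  rw [hdiv]
  exact ((differentiable_mvPolynomial_eval F).differentiableAt).fun_mul
    (((differentiable_mvPolynomial_eval U).differentiableAt).fun_inv hU)

/-- Hence, for `𝒱 = ℱ/𝒰` at such a point, the Landau expansion holds with `L = fderiv 𝒱(z)`:
`d/dλ|_{0} 𝒱(ι_λ(z)) = −i Σ_e z_e (∂𝒱/∂x_e(z))²`. [cite: BorinskyMunchTellander2023, §2.3 «Landau singularities» (main.tex l.455–458)] -/
theorem hasDerivAt_comp_iotaDeform_eval_div (F U : MvPolynomial E ℂ) {z : E → ℂ}
    (hU : MvPolynomial.eval z U ≠ 0) :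
    HasDerivAt (fun lam : ℂ =>
        (fun w : E → ℂ => MvPolynomial.eval w F / MvPolynomial.eval w U)
          (iotaDeform lam (fun e =>
            fderiv ℂ (fun w : E → ℂ => MvPolynomial.eval w F / MvPolynomial.eval w U) z (Pi.single e 1)) z))
      (-(Complex.I * ∑ e, z e *
        (fderiv ℂ (fun w : E → ℂ => MvPolynomial.eval w F / MvPolynomial.eval w U) z (Pi.single e 1)) ^ 2))
      0 :=
  hasDerivAt_comp_iotaDeform (differentiableAt_eval_div_eval F U hU).hasFDerivAt

end Literature.MathematicalPhysics.QuantumFieldTheory.BorinskyMunchTellander2023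

end
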